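import Mathlib
import HarnessLib
import Summits.HubbardSuperconductivity.HubbardSuperconductivity.Theses.LiebTwin
import Literature.MathematicalPhysics.QuantumLattice.HubbardHubbardModelEtaODLROProofs
import Literature.MathematicalPhysics.QuantumLattice.HubbardHubbardModelEtaPairingProofs
import Literature.MathematicalPhysics.QuantumLattice.HubbardLiebTwoHoppingsSector
import Literature.MathematicalPhysics.QuantumLattice.HubbardWave0LiebProofs
import Literature.MathematicalPhysics.QuantumLattice.HubbardLiebBasis

/-!
# Zhang's pseudospin-vector relation `[η_ε†, η₁] = N_A - N_B` (mixed Yang commutator)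

Helper file (`--supports stmt-HubbardSuperconductivity-0933`, crux `NoOnsiteODLRO`; route-prover LiebTwin-0,
session 5), algebraic input of the `δ = 0` endpoint (`LiebTwinNoOnsiteODLROHalfFillingEndpoint`): it
transfers the staggered CHARGE fluctuation of a pseudospin singlet to its on-site PAIR amplitude.

* `etaLower_mulVec_etaRaise_mulVec₂` — for two sign functions `ε, ε'`:
  `η_{ε'} (η_ε† f) = η_ε† (η_{ε'} f) + (Σ_x ε_x ε'_x (1 - [x↑ ∈ s] - [x↓ ∈ s])) f` (pair operators at
  distinct sites commute, the on-site commutator is `1 - n_x`; `ε' = ε` is the tree's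
  `EtaPairingODLRO.etaLower_mulVec_etaRaise_mulVec`).
* `etaRaise_mulVec_etaLowerOne_of_vacuum` — if `Σ_x ε_x = 0`, `ψ` has `N` particles and `η_ε† ψ = 0`, then
  `η_ε† (η₁ ψ) = 2 N_A ψ - N ψ`, `N_A = Σ_{ε_x = 1} (n_{x↑} + n_{x↓})`: the component
  `[η_ε†, η₁] = N_A - N_B` of Zhang's statement that `(η₁†, η₁, ½(N_A - N_B))` is a VECTOR under the
  pseudospin `SU(2)` generated by `(η_ε†, η_ε, η^z)`.
* `sum_torusStagger_cast_eq_zero` and the registered torus stub **`stub_halfFillingPseudospinVector`**.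

References: S.-C. Zhang, Phys. Rev. Lett. 65 (1990) 120 [Zhang1990]; C. N. Yang, S.-C. Zhang, Mod. Phys.
Lett. B 4 (1990) 759, Thm 1 [YangZhang1990]; C. N. Yang, Phys. Rev. Lett. 63 (1989) 2144, eq. (4)
[Yang1989]. Everything is proved; no definition and no named fact is introduced.
-/

-- the mandated namespace `Summit.<Summit>.<Problem>.Theorems` repeats `HubbardSuperconductivity`
set_option linter.dupNamespace false

noncomputable section

namespace Summit.HubbardSuperconductivity.HubbardSuperconductivity.Theorems.NoOnsiteODLRO.HalfFilling

open Matrix Finset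
open Literature.Probability.LatticeModels Literature.MathematicalPhysics.QuantumLattice
open scoped ComplexOrder

section MixedCommutator

variable {Λ : Type*} [LinearOrder Λ] [Fintype Λ]

/-- **Mixed Yang commutator** `[η_{ε'}, η_ε†] = Σ_x ε_x ε'_x (1 - n_{x↑} - n_{x↓})` at the level of Fock
vectors: `η_{ε'} (η_ε† f) = η_ε† (η_{ε'} f) + (Σ_x ε_x ε'_x (1 - [x↑ ∈ s] - [x↓ ∈ s])) f`
(pair operators at distinct sites commute; the on-site commutator is `1 - n_x`). For `ε' = ε` this is
`EtaPairingODLRO.etaLower_mulVec_etaRaise_mulVec`; for `ε' = 1`, `ε` the stagger, the right side is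
Zhang's pseudospin-vector relation `[η₁, η†] = -(N_A - N_B)`. Yang–Zhang, Mod. Phys. Lett. B 4 (1990)
759, Thm 1; Zhang, PRL 65 (1990) 120. [folklore] -/
theorem etaLower_mulVec_etaRaise_mulVec₂ (ε ε' : Λ → ℤˣ) (f : Fock (Orb Λ)) :
    etaLower ε' *ᵥ (etaRaise ε *ᵥ f) =
      etaRaise ε *ᵥ (etaLower ε' *ᵥ f) + fun s => (∑ x : Λ, ((ε x : ℤ) : ℂ) * ((ε' x : ℤ) : ℂ) *
        (1 - (if orb x 0 ∈ s then 1 else 0) - (if orb x 1 ∈ s then 1 else 0))) * f s := by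
  set R : Λ → Matrix (Finset (Orb Λ)) (Finset (Orb Λ)) ℂ :=
    fun x => creation (orb x 0) * creation (orb x 1) with hRdef
  set A : Λ → Matrix (Finset (Orb Λ)) (Finset (Orb Λ)) ℂ :=
    fun x => annihilation (orb x 1) * annihilation (orb x 0) with hAdef
  have hR : etaRaise ε = ∑ x, ((ε x : ℤ) : ℂ) • R x := rfl
  have hA : etaLower ε' = ∑ x, ((ε' x : ℤ) : ℂ) • A x := EtaPairingODLRO.etaLower_eq_sum' ε'
  have e1 : etaLower ε' *ᵥ (etaRaise ε *ᵥ f) =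
      ∑ x, ∑ y, (((ε x : ℤ) : ℂ) * ((ε' y : ℤ) : ℂ)) • (A y *ᵥ (R x *ᵥ f)) := by
    rw [hA, hR, sum_mulVec, sum_mulVec, Finset.sum_comm]
    refine Finset.sum_congr rfl fun x _ => ?_
    rw [smul_mulVec, mulVec_sum, Finset.smul_sum]
    refine Finset.sum_congr rfl fun y _ => ?_
    rw [smul_mulVec, mulVec_smul, smul_smul, mul_comm]
  have e2 : etaRaise ε *ᵥ (etaLower ε' *ᵥ f) =
      ∑ x, ∑ y, (((ε x : ℤ) : ℂ) * ((ε' y : ℤ) : ℂ)) • (R x *ᵥ (A y *ᵥ f)) := by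
    rw [hA, hR, sum_mulVec, sum_mulVec]
    refine Finset.sum_congr rfl fun x _ => ?_
    rw [smul_mulVec, mulVec_sum, Finset.smul_sum]
    refine Finset.sum_congr rfl fun y _ => ?_
    rw [smul_mulVec, mulVec_smul, smul_smul]
  rw [e1, e2, ← sub_eq_iff_eq_add', ← Finset.sum_sub_distrib]
  calc ∑ x, (∑ y, (((ε x : ℤ) : ℂ) * ((ε' y : ℤ) : ℂ)) • (A y *ᵥ (R x *ᵥ f)) -
          ∑ y, (((ε x : ℤ) : ℂ) * ((ε' y : ℤ) : ℂ)) • (R x *ᵥ (A y *ᵥ f)))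
      = ∑ x, (((ε x : ℤ) : ℂ) * ((ε' x : ℤ) : ℂ)) • (A x *ᵥ (R x *ᵥ f) - R x *ᵥ (A x *ᵥ f)) := by
        refine Finset.sum_congr rfl fun x _ => ?_
        rw [← Finset.sum_sub_distrib, Finset.sum_eq_single x]
        · rw [smul_sub]
        · intro y _ hyx
          rw [← smul_sub, EtaPairingODLRO.pairAnnihilation_pairCreation_comm (Ne.symm hyx), sub_self, smul_zero]
        · intro h; exact absurd (Finset.mem_univ x) h
    _ = fun s => (∑ x : Λ, ((ε x : ℤ) : ℂ) * ((ε' x : ℤ) : ℂ) *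
        (1 - (if orb x 0 ∈ s then 1 else 0) - (if orb x 1 ∈ s then 1 else 0))) * f s := by
        funext s
        rw [Finset.sum_apply, Finset.sum_mul]
        refine Finset.sum_congr rfl fun x _ => ?_
        rw [Pi.smul_apply, Pi.sub_apply, EtaPairingODLRO.pairAnnihilation_pairCreation_self x f s, smul_eq_mul]
        ring

/-- **Zhang's pseudospin-vector relation on an `η†`-vacuum.** If `Σ_x ε_x = 0` (equinumerous
sublattices), `ψ` is an `N`-particle vector and `η_ε† ψ = 0`, then
`η_ε† (η₁ ψ) = 2 N_A ψ - N ψ` with `N_A = Σ_{x : ε_x = 1} (n_{x↑} + n_{x↓})` the particle number of the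
sublattice `A = {ε = 1}` (i.e. `[η_ε†, η₁] = N_A - N_B` applied to `ψ`). Zhang, PRL 65 (1990) 120;
Yang–Zhang, Mod. Phys. Lett. B 4 (1990) 759, Thm 1. [folklore] -/
theorem etaRaise_mulVec_etaLowerOne_of_vacuum (ε : Λ → ℤˣ) (hε : ∑ x : Λ, ((ε x : ℤ) : ℂ) = 0)
    {N : ℕ} {ψ : Fock (Orb Λ)} (hN : IsNParticle N ψ) (hvac : etaRaise ε *ᵥ ψ = 0) :
    etaRaise ε *ᵥ (etaLower (fun _ : Λ => (1 : ℤˣ)) *ᵥ ψ) =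
      (2 : ℂ) • ((∑ x ∈ Finset.univ.filter (fun x : Λ => ε x = 1), ∑ σ : Fin 2, numberOp x σ) *ᵥ ψ) -
        (N : ℂ) • ψ := by
  have hmix := etaLower_mulVec_etaRaise_mulVec₂ ε (fun _ : Λ => (1 : ℤˣ)) ψ
  rw [hvac, mulVec_zero] at hmix
  have hy : etaRaise ε *ᵥ (etaLower (fun _ : Λ => (1 : ℤˣ)) *ᵥ ψ) = -fun s => (∑ x : Λ,
      ((ε x : ℤ) : ℂ) * (((1 : ℤˣ) : ℤ) : ℂ) *
        (1 - (if orb x 0 ∈ s then 1 else 0) - (if orb x 1 ∈ s then 1 else 0))) * ψ s := by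
    rw [eq_neg_iff_add_eq_zero]; exact hmix.symm
  rw [hy]
  funext s
  simp only [Pi.neg_apply, Pi.sub_apply, Pi.smul_apply, smul_eq_mul, Units.val_one, Int.cast_one, mul_one,
    Matrix.sum_mulVec, Finset.sum_apply, add_mulVec, Pi.add_apply, LiebTwo.numberOp_mulVec, Fin.sum_univ_two]
  by_cases hs : ψ s = 0
  · simp [hs]
  have hscard : (s.card : ℂ) = N := by
    by_contra h
    exact hs (hN s fun h' => h (by rw [h']))
  -- split the signed sum over the two sublattices
  set a : Λ → ℂ := fun x => (if orb x 0 ∈ s then 1 else 0) + (if orb x 1 ∈ s then 1 else 0) with ha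
  have hsplit : ∑ x : Λ, ((ε x : ℤ) : ℂ) * (1 - (if orb x 0 ∈ s then 1 else 0) - (if orb x 1 ∈ s then 1 else 0)) =
      ∑ x : Λ, ((ε x : ℤ) : ℂ) - ∑ x : Λ, ((ε x : ℤ) : ℂ) * a x := by
    rw [← Finset.sum_sub_distrib]
    exact Finset.sum_congr rfl fun x _ => by rw [ha]; ring
  have hsgn : ∑ x : Λ, ((ε x : ℤ) : ℂ) * a x =
      2 * ∑ x ∈ Finset.univ.filter (fun x : Λ => ε x = 1), a x - ∑ x : Λ, a x := by
    rw [← Finset.sum_filter_add_sum_filter_not Finset.univ (fun x : Λ => ε x = 1)]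
    conv_rhs => rw [← Finset.sum_filter_add_sum_filter_not Finset.univ (fun x : Λ => ε x = 1)]
    have hA' : ∑ x ∈ Finset.univ.filter (fun x : Λ => ε x = 1), ((ε x : ℤ) : ℂ) * a x =
        ∑ x ∈ Finset.univ.filter (fun x : Λ => ε x = 1), a x :=
      Finset.sum_congr rfl fun x hx => by rw [(Finset.mem_filter.1 hx).2]; simp
    have hB' : ∑ x ∈ Finset.univ.filter (fun x : Λ => ¬ε x = 1), ((ε x : ℤ) : ℂ) * a x =
        -∑ x ∈ Finset.univ.filter (fun x : Λ => ¬ε x = 1), a x := by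
      rw [← Finset.sum_neg_distrib]
      refine Finset.sum_congr rfl fun x hx => ?_
      rcases Int.units_eq_one_or (ε x) with h | h
      · exact absurd h (Finset.mem_filter.1 hx).2
      · rw [h]; simp
    rw [hA', hB']
    ring
  have htot : ∑ x : Λ, a x = (s.card : ℂ) := by rw [ha]; exact (EtaPairingODLRO.card_eq_sum_orb_mem s).symm
  rw [hsplit, hε, hsgn, htot, hscard, zero_sub, neg_mul, neg_neg, sub_mul]
  congr 1
  rw [mul_assoc, Finset.sum_mul]
  congr 1
  refine Finset.sum_congr rfl fun x _ => ?_
  rw [ha]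
  by_cases h0 : orb x 0 ∈ s <;> by_cases h1 : orb x 1 ∈ s <;> (simp [h0, h1]; try ring)

end MixedCommutator

section TorusVector

variable {L : ℕ} [NeZero L]

/-- The sign sum of the stagger vanishes on the torus of even side: `Σ_x ε_x = |A| - |B| = 0`. [folklore] -/
theorem sum_torusStagger_cast_eq_zero (hL : Even L) :
    ∑ x : FermionTorus 2 L, (((torusStagger x : ℤˣ) : ℤ) : ℂ) = 0 := by
  have hA := LiebTwoHoppings.two_mul_card_filter_torusStagger_eq_one (L := L) hL
  have hcard : Fintype.card (FermionTorus 2 L) = L ^ 2 := card_fermionTorus 2 L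
  rw [← Finset.sum_filter_add_sum_filter_not Finset.univ (fun x : FermionTorus 2 L => torusStagger x = 1)]
  have h1 : ∑ x ∈ Finset.univ.filter (fun x : FermionTorus 2 L => torusStagger x = 1),
      (((torusStagger x : ℤˣ) : ℤ) : ℂ) = ((Finset.univ.filter fun x : FermionTorus 2 L => torusStagger x = 1).card : ℂ) := by
    rw [Finset.card_eq_sum_ones, Nat.cast_sum]
    refine Finset.sum_congr rfl fun x hx => ?_
    rw [(Finset.mem_filter.1 hx).2]; simp
  have h2 : ∑ x ∈ Finset.univ.filter (fun x : FermionTorus 2 L => ¬torusStagger x = 1),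
      (((torusStagger x : ℤˣ) : ℤ) : ℂ) =
        -((Finset.univ.filter fun x : FermionTorus 2 L => ¬torusStagger x = 1).card : ℂ) := by
    rw [Finset.card_eq_sum_ones, Nat.cast_sum, ← Finset.sum_neg_distrib]
    refine Finset.sum_congr rfl fun x hx => ?_
    have hx' := (Finset.mem_filter.1 hx).2
    rcases Int.units_eq_one_or (torusStagger x) with h | h
    · exact absurd h hx'
    · rw [h]; simp
  rw [h1, h2]
  have hc := Finset.card_filter_add_card_filter_not (s := (Finset.univ : Finset (FermionTorus 2 L)))
    (fun x : FermionTorus 2 L => torusStagger x = 1)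
  rw [Finset.card_univ, hcard] at hc
  have : ((Finset.univ.filter fun x : FermionTorus 2 L => ¬torusStagger x = 1).card : ℂ) =
      ((Finset.univ.filter fun x : FermionTorus 2 L => torusStagger x = 1).card : ℂ) := by
    norm_cast
    omega
  rw [this, add_neg_cancel]


/-- **Registered stub `stub_halfFillingPseudospinVector`** of crux `NoOnsiteODLRO`
(stmt-HubbardSuperconductivity-0933; by-product — algebraic input of the `δ = 0` endpoint, not a piece of a
line composition): Zhang's relation on the torus of even side — for an `N`-particle `η_ε†`-vacuum `ψ`
(`ε` the stagger), `η_ε† (η₁ ψ) = 2 N_A ψ - N ψ` with `N_A` the particle number of the even sublattice.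
Zhang, PRL 65 (1990) 120; Yang–Zhang, Mod. Phys. Lett. B 4 (1990) 759. [cite: Zhang1990] -/
theorem stub_halfFillingPseudospinVector : open Literature.MathematicalPhysics.QuantumLattice in ∀ (L : ℕ) [NeZero L], Even L → ∀ (N : ℕ) (ψ : Fock (Orb (FermionTorus 2 L))), IsNParticle N ψ → etaRaise torusStagger *ᵥ ψ = 0 → etaRaise torusStagger *ᵥ (etaLower (fun _ : FermionTorus 2 L => (1 : ℤˣ)) *ᵥ ψ) = (2 : ℂ) • ((∑ x ∈ Finset.univ.filter (fun x : FermionTorus 2 L => torusStagger x = 1), ∑ σ : Fin 2, numberOp x σ) *ᵥ ψ) - (N : ℂ) • ψ :=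
  fun _L _ hL _N _ψ hN hvac => etaRaise_mulVec_etaLowerOne_of_vacuum torusStagger (sum_torusStagger_cast_eq_zero hL) hN hvac

end TorusVector

end Summit.HubbardSuperconductivity.HubbardSuperconductivity.Theorems.NoOnsiteODLRO.HalfFilling
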